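import Literature.RepresentationTheory.HeisenbergGroup.DoubledDeltaFrobenius
import Literature.RepresentationTheory.HeisenbergGroup.ImplementerIntertwinerTransport
import Literature.NumberTheory.Automorphic.LocalPiPartialFourierSum
import Literature.NumberTheory.Automorphic.LocalPiModulationInvariantFunctional
import HarnessLib

/-!
# `ℓ_Δ`-invariant functionals on the doubled Schrödinger model are multiples of the diagonal integral

Topic `RepresentationTheory/HeisenbergGroup`; namespace `Literature.RepresentationTheory.HeisenbergGroup`.  KERNEL ONLY:
theorems; no definition, no record, no named fact, no `sorry`.

Setting (tree `DoubledDeltaPolarisation.lean`, `DoubledDeltaFrobenius.lean`): `F` a non-archimedean local field with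
`2` invertible, `e : κ ⊕ κ ≃ ι`, a Gram matrix `T₀ : Matrix κ κ F` with `det T₀` a unit, the doubled Gram matrix
`T = reindex e e (T₀ ⊕ (−T₀))` (`hT`), `ψ` a continuous non-trivial character, `μ` an additive Haar measure on `F^κ`;
`ρ_T = schrodingerSB ⟨·, T ·⟩ ψ` the doubled smooth Schrödinger model on `𝒮(F^ι)`, `Λ_Δ = diagIntegral e μ` the
diagonal integral `Φ ↦ ∫ Φ(u ⊔ u) dμ`, `Φ_Δ = deltaHeisenbergEquiv` the change of polarisation to
`ℓ_∇ ⊕ ℓ_Δ` (Gram matrix `J_Δ = deltaGram e T₀`), `T_Δ = frobeniusToSchrodinger (ρ_T ∘ Φ_Δ⁻¹) Λ_Δ` the Frobenius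
intertwiner into the `ℓ_Δ`-model.

* §1 (generic, `SchrodingerFrobenius` setting) `frobeniusToSchrodinger_apply_zero`: `T_Λ f 0 = Λ f` (`inX 0 = 1`).
* §2 (generic Gram pairing `J` with `det J` a unit) **`exists_eq_mul_eval_zero_of_forall_inY`**: a linear functional
  on `𝒮(F^ι)` invariant under `ρ_J((0, y), 0)` for all `y` is `c · ev₀` — the tree's
  `exists_eq_mul_eval_zero_of_modulation_invariant` (every modulation `ψ(⟨·, η⟩)` is `ρ_J((0, J⁻¹η), 0)`).
* §3 the doubled setting: `isUnit_det_deltaGram` (`det J_Δ` is a unit); **`coe_deltaFrobenius_eq_partialFourierSum`**: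
  `T_Δ Φ = partialFourierSum ψ μ (2T₀) e Φ` — the tree's partial Fourier transform in the sum variable
  (`LocalPiPartialFourierSum.lean`), hence (`exists_deltaFrobeniusEquiv`) `T_Δ` is (the underlying map of) the LINEAR
  AUTOMORPHISM `𝒯 = partialFourierSumEquivSB μ hψ hm (2T₀) _ e` of `𝒮(F^ι)`, and any such `𝒯` intertwines `ρ_T` with
  the `ℓ_Δ`-Schrödinger model `ρ_Δ = schrodingerSB ⟨·, J_Δ ·⟩ ψ` on `𝒮(F^ι)` (`map_schrodingerSB_of_coe_eq_deltaFrobenius`).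
* §4 **MAIN `exists_eq_mul_diagIntegral_of_forall_deltaW`**: a linear functional `Λ` on `𝒮(F^ι)` with
  `Λ(ρ_T((α ⊔ α, β ⊔ β), 0) Φ) = Λ(Φ)` for all `α, β` (invariance under Weil's lift of the diagonal Lagrangian `ℓ_Δ`;
  the lift has no central part since `β_T` vanishes on `ℓ_Δ × ℓ_Δ`) is a multiple of the diagonal integral:
  **`∃ c, ∀ Φ, Λ Φ = c · ∫ Φ(u ⊔ u) dμ`**.  Proof: `μ' = Λ ∘ 𝒯⁻¹` is `Y_Δ`-invariant for `ρ_Δ` (transport of the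
  invariance along the intertwiner, `ImplementerIntertwinerTransport.intertwiner_symm_apply`, and
  `Φ_Δ⁻¹((0, q), 0) = (deltaW q_L q_R, 0)`), so `μ' = c · ev₀` by §2, and `ev₀ ∘ 𝒯 = Λ_Δ` by §1.
  This is the uniqueness of the `ℓ_Δ`-invariant functional on the doubled Weil representation, the algebraic heart of
  the doubling identity ([MoeglinVignerasWaldspurger1987] Chap. 2 II.6: the `(A, ψ_A)`-quasi-invariant functional on
  the metaplectic representation is unique up to a scalar for `A = A^⊥`; [Kudla1994] §2).

Written for the cell `hodgecm-mathlib` (fan B, rung B-IV, helper H15 of KEY `b4-howe-compact-irreducible`, route R6″ of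
the doubling proof of `MoeglinVignerasWaldspurger1987.mvw_IV4_rankOne_irreducibleOrZero`).  Nothing about theta lifts is
asserted here.

## References
* [MoeglinVignerasWaldspurger1987] C. Mœglin, M.-F. Vignéras, J.-L. Waldspurger, LNM 1291 (1987), Chap. 2 I.3, I.7, II.6.
* [Kudla1994] S. Kudla, *Splitting metaplectic covers of dual reductive pairs*, Israel J. Math. 87 (1994), §2.
-/

set_option autoImplicit false

noncomputable section

open _root_.MeasureTheory

namespace Literature.RepresentationTheory.HeisenbergGroup

open Literature.NumberTheory.Automorphic

/-! ## §1 The Frobenius map at the origin -/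

section General

universe u v w

variable {R : Type u} [CommRing R] {X Y : Type v} [AddCommGroup X] [Module R X] [AddCommGroup Y] [Module R Y]
  (β : X →ₗ[R] Y →ₗ[R] R) {S : Type w} [AddCommGroup S] [Module ℂ S] (ρ : Representation ℂ (Heisenberg (polar β)) S)

/-- `inX 0 = 1`. [cite: MoeglinVignerasWaldspurger1987, Chap. 2 I.4 Exemple (1)] -/
@[simp] theorem inX_zero : inX β (0 : X) = 1 := rfl

/-- `inY 0 = 1`. [cite: MoeglinVignerasWaldspurger1987, Chap. 2 I.4 Exemple (1)] -/
@[simp] theorem inY_zero : inY β (0 : Y) = 1 := rfl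

/-- **`T_Λ f (0) = Λ f`**: the Frobenius map followed by evaluation at the origin is the functional itself.
[cite: MoeglinVignerasWaldspurger1987, Chap. 2 I.3] -/
theorem frobeniusToSchrodinger_apply_zero (Λ : S →ₗ[ℂ] ℂ) (f : S) : frobeniusToSchrodinger ρ Λ f 0 = Λ f := by
  rw [frobeniusToSchrodinger_apply, inX_zero, map_one, Module.End.one_apply]

end General

/-! ## §2 `Y`-invariant functionals on a Gram Schrödinger model are multiples of evaluation at `0` -/

section Gram

variable {F : Type*} [Field F] [ValuativeRel F] [TopologicalSpace F] [IsNonarchimedeanLocalField F]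
  {ι : Type*} [Fintype ι] [DecidableEq ι] (J : Matrix ι ι F) (hJ : IsUnit J.det)
  {ψ : AddChar F Circle} (hl : IsLocallyConstant (⇑ψ : F → Circle))
  (hbJ : ∀ y : ι → F, Continuous fun u : ι → F => Matrix.toLinearMap₂' F J u y)

include hJ in
/-- **a `Y`-invariant linear functional on `𝒮(F^ι)` is `c · ev₀`**: if `Λ(ρ_J((0, y), 0) f) = Λ(f)` for all `y`
(`ρ_J = schrodingerSB ⟨·, J ·⟩ ψ`, `det J` a unit, `ψ` continuous non-trivial), then `Λ f = c · f(0)`; every modulation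
`ψ(⟨·, η⟩)` is `ρ_J((0, J⁻¹ η), 0)`. [cite: MoeglinVignerasWaldspurger1987, Chap. 2 II.6] -/
theorem exists_eq_mul_eval_zero_of_forall_inY (hψ : ψ.IsContinuousNontrivial)
    (Λ : SchwartzBruhat (ι → F) →ₗ[ℂ] ℂ)
    (hΛ : ∀ (y : ι → F) (f : SchwartzBruhat (ι → F)),
      Λ (schrodingerSB (Matrix.toLinearMap₂' F J) ψ hl hbJ (inY _ y) f) = Λ f) :
    ∃ c : ℂ, ∀ f : SchwartzBruhat (ι → F), Λ f = c * (f : (ι → F) → ℂ) 0 := by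
  refine exists_eq_mul_eval_zero_of_modulation_invariant Λ (fun η f g hg => ?_) hψ
  obtain ⟨y, hy⟩ := (Matrix.mulVec_surjective_iff_isUnit.2 ((Matrix.isUnit_iff_isUnit_det J).2 hJ)) η
  have hgf : g = schrodingerSB (Matrix.toLinearMap₂' F J) ψ hl hbJ (inY _ y) f := by
    apply Subtype.ext
    funext x
    rw [hg x, schrodingerSB_apply]
    simp only [inY_t, inY_v, zero_add, add_zero, Matrix.toLinearMap₂'_apply']
    rw [← hy]
  rw [hgf, hΛ]

end Gram

/-! ## §3 The doubled setting: `det J_Δ`, the Frobenius map as the partial Fourier transform, the intertwiner -/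

section Doubled

variable {F : Type*} [Field F] [ValuativeRel F] [TopologicalSpace F] [IsNonarchimedeanLocalField F]
  {κ ι : Type*} [Fintype κ] [Fintype ι] [DecidableEq κ] [DecidableEq ι]
  (e : κ ⊕ κ ≃ ι) (T₀ : Matrix κ κ F) {T : Matrix ι ι F}
  (hT : T = Matrix.reindex e e (Matrix.fromBlocks T₀ 0 0 (-T₀)))
  {ψ : AddChar F Circle} (hl : IsLocallyConstant (⇑ψ : F → Circle))
  (hb : ∀ y : ι → F, Continuous fun u : ι → F => Matrix.toLinearMap₂' F T u y)
  [MeasurableSpace (κ → F)] [BorelSpace (κ → F)] (μ : Measure (κ → F)) [μ.IsAddHaarMeasure]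
  [Invertible (2 : F)]

omit [ValuativeRel F] [TopologicalSpace F] [IsNonarchimedeanLocalField F] [MeasurableSpace (κ → F)]
  [BorelSpace (κ → F)] in
/-- `det (2T₀)` is a unit when `det T₀` is (`2` invertible) — the Gram matrix `2T₀` of the pairing between `ℓ_∇` and
`ℓ_Δ`. [cite: Kudla1994, §2] -/
theorem isUnit_det_two_smul (hT₀ : IsUnit T₀.det) : IsUnit ((2 : F) • T₀).det := by
  rw [Matrix.det_smul]
  exact (IsUnit.pow _ (isUnit_of_invertible (2 : F))).mul hT₀

omit [ValuativeRel F] [TopologicalSpace F] [IsNonarchimedeanLocalField F] [MeasurableSpace (κ → F)]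
  [BorelSpace (κ → F)] in
/-- **(1) `det J_Δ` is a unit** (`J_Δ = (0, 2T₀; −2T₀ᵀ, 0)` read through `e`; explicit inverse
`(0, (−2T₀ᵀ)⁻¹; (2T₀)⁻¹, 0)`). [cite: Kudla1994, §2] -/
theorem isUnit_det_deltaGram (hT₀ : IsUnit T₀.det) : IsUnit (deltaGram e T₀).det := by
  have h2 : IsUnit ((2 : F) • T₀).det := isUnit_det_two_smul T₀ hT₀
  have h2' : IsUnit (-((2 : F) • T₀.transpose)).det := by
    rw [Matrix.det_neg, Matrix.det_smul, Matrix.det_transpose]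
    exact (IsUnit.pow _ isUnit_one.neg).mul ((IsUnit.pow _ (isUnit_of_invertible (2 : F))).mul hT₀)
  rw [deltaGram, Matrix.det_reindex_self]
  refine Matrix.isUnit_det_of_right_inverse
    (B := Matrix.fromBlocks 0 (-((2 : F) • T₀.transpose))⁻¹ ((2 : F) • T₀)⁻¹ 0) ?_
  rw [Matrix.fromBlocks_multiply]
  simp only [Matrix.zero_mul, Matrix.mul_zero, zero_add, add_zero, Matrix.mul_nonsing_inv _ h2,
    Matrix.mul_nonsing_inv _ h2', Matrix.fromBlocks_one]

omit [ValuativeRel F] [TopologicalSpace F] [IsNonarchimedeanLocalField F] [MeasurableSpace (κ → F)]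
  [BorelSpace (κ → F)] [Invertible (2 : F)] in
/-- `u ⬝ᵥ (2T₀) b = 2 ⟨u, T₀ b⟩` (the pairing between `ℓ_∇` and `ℓ_Δ` in the coordinates `a ⊔ b`). [cite: Kudla1994, §2] -/
theorem dotProduct_two_smul_mulVec (u b : κ → F) :
    u ⬝ᵥ (((2 : F) • T₀).mulVec b) = 2 * Matrix.toLinearMap₂' F T₀ u b := by
  rw [Matrix.smul_mulVec, dotProduct_smul, smul_eq_mul, Matrix.toLinearMap₂'_apply']

include hT in
/-- **(2) the Frobenius map `T_Δ` IS the partial Fourier transform in the sum variable** (for the matrix `2T₀`):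
`T_Δ Φ = partialFourierSum ψ μ (2T₀) e Φ` as functions on `F^ι`. [cite: MoeglinVignerasWaldspurger1987, Chap. 2 I.7] -/
theorem coe_deltaFrobenius_eq_partialFourierSum (Φ : SchwartzBruhat (ι → F)) :
    frobeniusToSchrodinger ((schrodingerSB (Matrix.toLinearMap₂' F T) ψ hl hb).comp
        (deltaHeisenbergEquiv e T₀ hT).symm.toMonoidHom : Representation ℂ _ (SchwartzBruhat (ι → F)))
        (diagIntegral e μ) Φ =
      partialFourierSum ψ μ ((2 : F) • T₀) e Φ := by
  funext v
  rw [← glue_resL_resR e v, deltaFrobenius_apply_glue e T₀ hT hl hb μ, partialFourierSum_apply_glue]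
  simp only [dotProduct_two_smul_mulVec]

include hT in
/-- the tree's automorphism `partialFourierSumEquivSB μ hψ hm (2T₀) _ e` of `𝒮(F^ι)` has underlying map `T_Δ`.
[cite: MoeglinVignerasWaldspurger1987, Chap. 2 I.7] -/
theorem coe_partialFourierSumEquivSB_two_smul_eq_deltaFrobenius (hψ : ψ.IsContinuousNontrivial) {m : ℤ}
    (hm : ψ.HasConductorExp m) (hT₀ : IsUnit T₀.det) (Φ : SchwartzBruhat (ι → F)) :
    ((partialFourierSumEquivSB μ hψ hm ((2 : F) • T₀) (isUnit_det_two_smul T₀ hT₀) e Φ :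
        SchwartzBruhat (ι → F)) : (ι → F) → ℂ) =
      frobeniusToSchrodinger ((schrodingerSB (Matrix.toLinearMap₂' F T) ψ hl hb).comp
        (deltaHeisenbergEquiv e T₀ hT).symm.toMonoidHom : Representation ℂ _ (SchwartzBruhat (ι → F)))
        (diagIntegral e μ) Φ := by
  rw [coe_partialFourierSumEquivSB, coe_deltaFrobenius_eq_partialFourierSum e T₀ hT hl hb μ]

include hT in
/-- **(3) `T_Δ` is the underlying map of a linear automorphism of `𝒮(F^ι)`** (stability + partial Fourier
inversion, from `LocalPiPartialFourierSum`). [cite: MoeglinVignerasWaldspurger1987, Chap. 2 I.7] -/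
theorem exists_deltaFrobeniusEquiv (hψ : ψ.IsContinuousNontrivial) (hT₀ : IsUnit T₀.det) :
    ∃ 𝒯 : SchwartzBruhat (ι → F) ≃ₗ[ℂ] SchwartzBruhat (ι → F), ∀ Φ : SchwartzBruhat (ι → F),
      ((𝒯 Φ : SchwartzBruhat (ι → F)) : (ι → F) → ℂ) =
        frobeniusToSchrodinger ((schrodingerSB (Matrix.toLinearMap₂' F T) ψ hl hb).comp
          (deltaHeisenbergEquiv e T₀ hT).symm.toMonoidHom : Representation ℂ _ (SchwartzBruhat (ι → F)))
          (diagIntegral e μ) Φ := by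
  obtain ⟨m, hm⟩ := hψ.exists_hasConductorExp
  exact ⟨_, coe_partialFourierSumEquivSB_two_smul_eq_deltaFrobenius e T₀ hT hl hb μ hψ hm hT₀⟩

include hT in
/-- **any operator on `𝒮(F^ι)` with underlying map `T_Δ` intertwines `ρ_T` with the `ℓ_Δ`-Schrödinger model**
`ρ_Δ = schrodingerSB ⟨·, J_Δ ·⟩ ψ` along `Φ_Δ`: `𝒯 (ρ_T(h) Φ) = ρ_Δ(Φ_Δ h) (𝒯 Φ)` in `𝒮(F^ι)`.
[cite: MoeglinVignerasWaldspurger1987, Chap. 2 I.7] -/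
theorem map_schrodingerSB_of_coe_eq_deltaFrobenius
    (hbΔ : ∀ y : ι → F, Continuous fun u : ι → F => Matrix.toLinearMap₂' F (deltaGram e T₀) u y)
    (𝒯 : SchwartzBruhat (ι → F) →ₗ[ℂ] SchwartzBruhat (ι → F))
    (h𝒯 : ∀ Φ : SchwartzBruhat (ι → F), ((𝒯 Φ : SchwartzBruhat (ι → F)) : (ι → F) → ℂ) =
      frobeniusToSchrodinger ((schrodingerSB (Matrix.toLinearMap₂' F T) ψ hl hb).comp
        (deltaHeisenbergEquiv e T₀ hT).symm.toMonoidHom : Representation ℂ _ (SchwartzBruhat (ι → F)))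
        (diagIntegral e μ) Φ)
    (h : Heisenberg (polar (Matrix.toLinearMap₂' F T))) (Φ : SchwartzBruhat (ι → F)) :
    𝒯 (schrodingerSB (Matrix.toLinearMap₂' F T) ψ hl hb h Φ) =
      schrodingerSB (Matrix.toLinearMap₂' F (deltaGram e T₀)) ψ hl hbΔ (deltaHeisenbergEquiv e T₀ hT h) (𝒯 Φ) := by
  apply Subtype.ext
  rw [h𝒯, deltaFrobenius_apply_schrodingerSB e T₀ hT hl hb μ, coe_schrodingerSB, h𝒯]

include hT in
/-- the same for a linear equivalence `𝒯`. [cite: MoeglinVignerasWaldspurger1987, Chap. 2 I.7] -/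
theorem equiv_schrodingerSB_of_coe_eq_deltaFrobenius
    (hbΔ : ∀ y : ι → F, Continuous fun u : ι → F => Matrix.toLinearMap₂' F (deltaGram e T₀) u y)
    (𝒯 : SchwartzBruhat (ι → F) ≃ₗ[ℂ] SchwartzBruhat (ι → F))
    (h𝒯 : ∀ Φ : SchwartzBruhat (ι → F), ((𝒯 Φ : SchwartzBruhat (ι → F)) : (ι → F) → ℂ) =
      frobeniusToSchrodinger ((schrodingerSB (Matrix.toLinearMap₂' F T) ψ hl hb).comp
        (deltaHeisenbergEquiv e T₀ hT).symm.toMonoidHom : Representation ℂ _ (SchwartzBruhat (ι → F)))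
        (diagIntegral e μ) Φ)
    (h : Heisenberg (polar (Matrix.toLinearMap₂' F T))) (Φ : SchwartzBruhat (ι → F)) :
    𝒯 (schrodingerSB (Matrix.toLinearMap₂' F T) ψ hl hb h Φ) =
      schrodingerSB (Matrix.toLinearMap₂' F (deltaGram e T₀)) ψ hl hbΔ (deltaHeisenbergEquiv e T₀ hT h) (𝒯 Φ) :=
  map_schrodingerSB_of_coe_eq_deltaFrobenius e T₀ hT hl hb μ hbΔ 𝒯.toLinearMap h𝒯 h Φ

include hT in
/-- **the named automorphism intertwines**: `𝒯 = partialFourierSumEquivSB μ hψ hm (2T₀) _ e` satisfies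
`𝒯 (ρ_T(h) Φ) = ρ_Δ(Φ_Δ h) (𝒯 Φ)`. [cite: MoeglinVignerasWaldspurger1987, Chap. 2 I.7] -/
theorem partialFourierSumEquivSB_schrodingerSB (hψ : ψ.IsContinuousNontrivial) {m : ℤ} (hm : ψ.HasConductorExp m)
    (hT₀ : IsUnit T₀.det)
    (hbΔ : ∀ y : ι → F, Continuous fun u : ι → F => Matrix.toLinearMap₂' F (deltaGram e T₀) u y)
    (h : Heisenberg (polar (Matrix.toLinearMap₂' F T))) (Φ : SchwartzBruhat (ι → F)) :
    partialFourierSumEquivSB μ hψ hm ((2 : F) • T₀) (isUnit_det_two_smul T₀ hT₀) e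
        (schrodingerSB (Matrix.toLinearMap₂' F T) ψ hl hb h Φ) =
      schrodingerSB (Matrix.toLinearMap₂' F (deltaGram e T₀)) ψ hl hbΔ (deltaHeisenbergEquiv e T₀ hT h)
        (partialFourierSumEquivSB μ hψ hm ((2 : F) • T₀) (isUnit_det_two_smul T₀ hT₀) e Φ) :=
  equiv_schrodingerSB_of_coe_eq_deltaFrobenius e T₀ hT hl hb μ hbΔ _
    (coe_partialFourierSumEquivSB_two_smul_eq_deltaFrobenius e T₀ hT hl hb μ hψ hm hT₀) h Φ

/-! ## §4 `ℓ_Δ`-invariant functionals are multiples of the diagonal integral -/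

include hT in
/-- **a functional `Λ` on `𝒮(F^ι)` pulled back along an operator `𝒯` with underlying map `T_Δ`**: if `Λ` is
`ℓ_Δ`-invariant for `ρ_T`, then `Λ ∘ 𝒯⁻¹` is `Y_Δ`-invariant for `ρ_Δ`. [cite: MoeglinVignerasWaldspurger1987, Chap. 2 II.6] -/
theorem comp_symm_schrodingerSB_inY_of_forall_deltaW
    (hbΔ : ∀ y : ι → F, Continuous fun u : ι → F => Matrix.toLinearMap₂' F (deltaGram e T₀) u y)
    (𝒯 : SchwartzBruhat (ι → F) ≃ₗ[ℂ] SchwartzBruhat (ι → F))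
    (h𝒯 : ∀ Φ : SchwartzBruhat (ι → F), ((𝒯 Φ : SchwartzBruhat (ι → F)) : (ι → F) → ℂ) =
      frobeniusToSchrodinger ((schrodingerSB (Matrix.toLinearMap₂' F T) ψ hl hb).comp
        (deltaHeisenbergEquiv e T₀ hT).symm.toMonoidHom : Representation ℂ _ (SchwartzBruhat (ι → F)))
        (diagIntegral e μ) Φ)
    (Λ : SchwartzBruhat (ι → F) →ₗ[ℂ] ℂ)
    (hΛ : ∀ (α β : κ → F) (Φ : SchwartzBruhat (ι → F)),
      Λ (schrodingerSB (Matrix.toLinearMap₂' F T) ψ hl hb ⟨deltaW e α β, 0⟩ Φ) = Λ Φ)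
    (q : ι → F) (f : SchwartzBruhat (ι → F)) :
    Λ (𝒯.symm (schrodingerSB (Matrix.toLinearMap₂' F (deltaGram e T₀)) ψ hl hbΔ (inY _ q) f)) = Λ (𝒯.symm f) := by
  rw [intertwiner_symm_apply (equiv_schrodingerSB_of_coe_eq_deltaFrobenius e T₀ hT hl hb μ hbΔ 𝒯 h𝒯) (inY _ q) f,
    deltaHeisenbergEquiv_symm_inY e T₀ hT, hΛ]

include hT in
/-- **(5) MAIN — an `ℓ_Δ`-invariant linear functional on the doubled Schrödinger model is a multiple of the diagonal
integral**: if `Λ(ρ_T((α ⊔ α, β ⊔ β), 0) Φ) = Λ(Φ)` for all `α, β : F^κ` and all `Φ ∈ 𝒮(F^ι)` (`det T₀` a unit,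
`ψ` continuous non-trivial, `μ` a Haar measure), then `∃ c, ∀ Φ, Λ Φ = c · ∫ Φ(u ⊔ u) dμ(u)`.
[cite: MoeglinVignerasWaldspurger1987, Chap. 2 II.6] -/
theorem exists_eq_mul_diagIntegral_of_forall_deltaW (hψ : ψ.IsContinuousNontrivial) (hT₀ : IsUnit T₀.det)
    (Λ : SchwartzBruhat (ι → F) →ₗ[ℂ] ℂ)
    (hΛ : ∀ (α β : κ → F) (Φ : SchwartzBruhat (ι → F)),
      Λ (schrodingerSB (Matrix.toLinearMap₂' F T) ψ hl hb ⟨deltaW e α β, 0⟩ Φ) = Λ Φ) :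
    ∃ c : ℂ, ∀ Φ : SchwartzBruhat (ι → F), Λ Φ = c * diagIntegral e μ Φ := by
  have hbΔ : ∀ y : ι → F, Continuous fun u : ι → F => Matrix.toLinearMap₂' F (deltaGram e T₀) u y :=
    fun y => continuous_toLinearMap₂'_left (deltaGram e T₀) y
  -- an automorphism `𝒯` of `𝒮(F^ι)` with underlying map `T_Δ`, and the pulled-back functional `μ' = Λ ∘ 𝒯⁻¹`
  obtain ⟨𝒯, h𝒯⟩ := exists_deltaFrobeniusEquiv e T₀ hT hl hb μ hψ hT₀
  obtain ⟨c, hc⟩ := exists_eq_mul_eval_zero_of_forall_inY (deltaGram e T₀) (isUnit_det_deltaGram e T₀ hT₀) hl hbΔ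
    hψ (Λ ∘ₗ 𝒯.symm.toLinearMap) fun q f => by
      rw [LinearMap.comp_apply, LinearMap.comp_apply, LinearEquiv.coe_toLinearMap]
      exact comp_symm_schrodingerSB_inY_of_forall_deltaW e T₀ hT hl hb μ hbΔ 𝒯 h𝒯 Λ hΛ q f
  refine ⟨c, fun Φ => ?_⟩
  have h1 : Λ Φ = (Λ ∘ₗ 𝒯.symm.toLinearMap) (𝒯 Φ) := by
    rw [LinearMap.comp_apply, LinearEquiv.coe_toLinearMap, LinearEquiv.symm_apply_apply]
  rw [h1, hc, h𝒯 Φ, frobeniusToSchrodinger_apply_zero]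

end Doubled

end Literature.RepresentationTheory.HeisenbergGroup

end
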